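import Summits.PneNP.PneNP.Theorems.NegLimitedGapPMExp

/-!
# Route NegLimited — T5⁺ `GapPerfectMatchingExp` and item T5 `GapPerfectMatchingQuasipoly` PROVED (rung F-N1/p3, line r7-crosscut)

Assembly of the line `r7-crosscut` of item stmt-PneNP-19861 (cell pnp-ideate, HOME/pnp-ideate-p3/ROUND-7.md,
Skeleton-R7-crosscut-v3.lean): the biased Matching Sunflower Lemma (`biasedMatchingSunflower_holds`,
`NegLimitedBiasedMatchingSunflower.lean`), the deficiency of small cross-cut graphs (`crossDeficient_holds`)
and their mass (`deficientMass_holds`) feed the `μ`-closure engine run `gapPMExp_of`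
(`NegLimitedGapPMExp.lean`), giving

* `gapPerfectMatchingExp_holds : GapPerfectMatchingExp` — **T5⁺** (new theorem, not in print): for every gap
  `K ≥ 2` and `δ > 0`, eventually every monotone circuit accepting all bipartite graphs on `m + m` vertices
  with a perfect matching and rejecting all `K`-deficient graphs has at least `2^{m^{1/3-δ}}` gates;
* `gapPerfectMatchingQuasipoly_holds : NegLimited.GapPerfectMatchingQuasipoly` — the route item **T5**
  (stmt-PneNP-19861) BY NAME, via `quasipoly_of_exp_holds` (`NegLimitedGapPMQuasipolyOfExp.lean`).

The registered stub `stub_gapPMExp` (whose signature also carries `HeteroDomination`, unused) is the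
one-liner of `NegLimitedGapPMExpStub.lean`. No hypothesis of the paper kind remains: every input is a
theorem of the tree (robust sunflower theorem `robust_sunflower_spreadConst`, CKR closure calculus,
Razborov's approximation method `ApproxScheme.exists_approx_circuit`).
-/

set_option linter.dupNamespace false -- `Summit.PneNP.PneNP.…`: summit = sub-problem name (D-0017 single-conjunct layout)

namespace Summit.PneNP.PneNP.Theorems.NegLimitedGapPM

/-- **T5⁺ proved**: the gap-robust exponential monotone lower bound for bipartite perfect matching. -/
theorem gapPerfectMatchingExp_holds : GapPerfectMatchingExp := by
  obtain ⟨c₀, hc₀, hSF⟩ := exists_sunflowerBound biasedMatchingSunflower_holds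
  exact gapPMExp_of hSF hc₀ crossDeficient_holds deficientMass_holds

end Summit.PneNP.PneNP.Theorems.NegLimitedGapPM

namespace Summit.PneNP.PneNP.Theorems

/-- **Item stmt-PneNP-19861 (`NegLimited.GapPerfectMatchingQuasipoly`, T5) PROVED, by name**: for every
`K ≥ 2` there is `c > 0` (here `c = 1`) such that, eventually in `m`, monotone circuits separating
"has a perfect matching" from "`K`-deficient" have at least `m^{c log m}` gates. -/
theorem gapPerfectMatchingQuasipoly_holds :
    Summit.PneNP.PneNP.Theses.NegLimited.GapPerfectMatchingQuasipoly :=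
  NegLimitedGapPM.quasipoly_of_exp_holds NegLimitedGapPM.gapPerfectMatchingExp_holds

end Summit.PneNP.PneNP.Theorems
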